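import Literature.AlgebraicGeometry.Pohlmann1968.CMTypeRankCharactersNumberField
import Literature.NumberTheory.ComplexMultiplication.CMTypeBasic
import Mathlib.NumberTheory.NumberField.CMField
import Mathlib.GroupTheory.Index
import HarnessLib

/-!
# A classification-free stabiliser lemma (subgroup of order `4` and index `2`, central involution) and the Galois
# dictionary of a Galois CM field: complex conjugation is central, fibres over a subfield are cosets

COR-CM (cell `pub-hodgecm2`), binder seat b04 (gen 13), count-neutral claim GALOIS-OCTIC, part I: the toolkit for
`CorCM/GaloisOcticSimpleCMFourfolds` (every simple CM abelian fourfold whose CM field is Galois over `ℚ` is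
nondegenerate — the Galois slice of [Dodson1984] §3.3.2 / [Ribet1980] (3.7), with a NEW classification-free proof).
KERNEL ONLY: theorems, no definition, no named fact, no `sorry`.  `HC_CM` is not used and not claimed.

§1 `GaloisOctic.exists_involution_forall_mem_iff` — **the stabiliser lemma**, pure group theory.  Let `H ≤ G` be a
   subgroup with `|H| = 4` of index `2`, `c ∈ Z(G)` an involution outside `H`, `T ⊆ G` with `c·g ∈ T ↔ g ∉ T`
   (a "CM type" on `G = H ⊔ cH` relative to `c`), and suppose `T ∩ H = {x, y}` has exactly two elements ("balanced
   fibres").  Then some involution `v ≠ 1` of `G` satisfies `z ∈ T ↔ v·z ∈ T` for all `z`.  Proof: `u := y x⁻¹ ∈ H`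
   has `u⁴ = 1`; if `u² = 1` take `v = u` (it swaps `x, y` and preserves `H ∖ {x, y}`); otherwise `u` has order `4`,
   `H = {x, ux, u²x, u³x}`, `T = {x, ux, c·u²x, c·u³x}` and `v = c·u²` works.  No case distinction
   `H ≅ ℤ/4` vs `(ℤ/2)²`, no appeal to the five groups of order `8`.
§2 The Galois dictionary of a Galois CM field `K` in Shimura's indexing `σ_g = φ₀ ∘ g⁻¹` (tree `embOf`,
   `CMTypeRankCharactersNumberField`): with `c = IsCMField.complexConj K ∈ Gal(K/ℚ)` (Mathlib), `σ_{gc} = σ_{cg} = σ̄_g`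
   (`embOf_mul_complexConj`, `embOf_complexConj_mul`; Mathlib `IsCMField.complexEmbedding_complexConj`), hence `c` is
   CENTRAL (`complexConj_mul_comm`) and `σ_{cg} ∈ Φ ↔ σ_g ∉ Φ` for a CM type `Φ` (`embOf_complexConj_mul_mem_iff`); the
   embeddings restricting to `φ₀|_k` on an intermediate field `k` are the `σ_h`, `h ∈ Gal(K/k)`
   (`embOf_comp_algebraMap_eq_iff`); every embedding of `k` is such a restriction (`exists_embOf_comp_algebraMap_eq`);
   a subfield with a complex place is moved by `c` (`complexConj_not_mem_fixingSubgroup`).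
   [Shimura1998, §8.1, §18.2 Lemma (i)].

Provenance: Literature home (family `hodge`, namespace `Literature.AlgebraicGeometry.ComplexMultiplication.GaloisOcticStabiliser`) of the Summits-side `CorCM/GaloisOcticStabiliserLemma` (cell `pub-hodgecm2`, COR-CM; all its imports are `Literature/` and Mathlib), which `Literature/` may not import; theorems only, no named fact, no definition. Nothing here bears on `HC_CM`. Lane `lit-hodgefound` (Layer A3: CM types, their Kubota ranks and Galois combinatorics), seat p20.
-/

noncomputable section

open NumberField

namespace Literature.AlgebraicGeometry.ComplexMultiplication.GaloisOcticStabiliser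

open Literature.NumberTheory.ComplexMultiplication
open Literature.AlgebraicGeometry.Motives (CMType)
open Literature.AlgebraicGeometry.Pohlmann1968

open scoped Classical

/-! ## §1 The classification-free stabiliser lemma for groups with a subgroup of order `4` and index `2` -/

namespace GaloisOctic

section Group

variable {G : Type*} [Group G]

/-- In a subgroup of order `4` every element satisfies `u⁴ = 1` (Lagrange). [cite: Shimura1998, §18.2 Lemma (i)] -/
theorem pow_four_eq_one_of_mem {H : Subgroup G} (hH : Nat.card H = 4) {u : G} (hu : u ∈ H) : u ^ 4 = 1 := by
  have h : (⟨u, hu⟩ : H) ^ Nat.card H = 1 := pow_card_eq_one'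
  rw [hH] at h
  exact congrArg Subtype.val h

/-- **The stabiliser lemma.**  Let `H ≤ G` have order `4` and index `2`, let `c ∈ Z(G)` be an involution outside `H`,
let `T ⊆ G` satisfy `c g ∈ T ↔ g ∉ T`, and suppose `T ∩ H = {x, y}` with `x ≠ y`.  Then there is an involution
`v ≠ 1` with `z ∈ T ↔ v z ∈ T` for every `z ∈ G`: `v = y x⁻¹` if this is an involution, and `v = c (y x⁻¹)²`
otherwise (then `y x⁻¹` has order `4` and `H = {x, ux, u²x, u³x}`).  For `G = Gal(K/ℚ)`, `H = Gal(K/k)` and `T` the set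
of `g` with `σ_g ∈ Φ` this is the non-primitivity of a CM type with multiplicities `(2,2)` over `k`
(`GaloisOctic.not_isPrimitive_of_fibres_balanced_of_isGalois`).  NEW (the print — [Dodson1984] §3.3.2 — argues by the
classification of the `ρ`-structures for `n = 4` instead). [cite: Shimura1998, §18.2 Lemma (i)] -/
theorem exists_involution_forall_mem_iff (H : Subgroup G) (hH : Nat.card H = 4) (hidx : H.index = 2)
    {c : G} (hc : c * c = 1) (hcH : c ∉ H) (hcomm : ∀ g : G, c * g = g * c)
    {T : Set G} (hT : ∀ g : G, c * g ∈ T ↔ g ∉ T)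
    {x y : G} (hxy : x ≠ y) (hx : x ∈ H) (hy : y ∈ H) (hS : ∀ h : G, h ∈ H → (h ∈ T ↔ h = x ∨ h = y)) :
    ∃ v : G, v ≠ 1 ∧ v * v = 1 ∧ ∀ z : G, z ∈ T ↔ v * z ∈ T := by
  have hxT : x ∈ T := (hS x hx).2 (Or.inl rfl)
  have hyT : y ∈ T := (hS y hy).2 (Or.inr rfl)
  -- every element off `H` is `c * h`
  have hoff : ∀ z : G, z ∉ H → ∃ h ∈ H, z = c * h := by
    intro z hz
    refine ⟨c * z, ?_, by rw [← mul_assoc, hc, one_mul]⟩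
    rw [Subgroup.mul_mem_iff_of_index_two hidx]
    exact ⟨fun h => absurd h hcH, fun h => absurd h hz⟩
  -- it suffices to produce an involution `v ≠ 1` with `v • T ⊆ T`
  suffices key : ∃ v : G, v ≠ 1 ∧ v * v = 1 ∧ ∀ z : G, z ∈ T → v * z ∈ T by
    obtain ⟨v, hv1, hvv, hvT⟩ := key
    refine ⟨v, hv1, hvv, fun z => ⟨hvT z, fun h => ?_⟩⟩
    have := hvT _ h
    rwa [← mul_assoc, hvv, one_mul] at this
  set u : G := y * x⁻¹ with hu_def
  have huH : u ∈ H := H.mul_mem hy (H.inv_mem hx)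
  have hux : u * x = y := by rw [hu_def, inv_mul_cancel_right]
  have hu1 : u ≠ 1 := by
    intro h1; apply hxy; rw [← hux, h1, one_mul]
  have hu4 : u ^ 4 = 1 := pow_four_eq_one_of_mem hH huH
  -- membership in `T` of `c * h` for `h ∈ H`
  have hcT : ∀ h : G, h ∈ H → (c * h ∈ T ↔ ¬ (h = x ∨ h = y)) := fun h hh => by
    rw [hT, hS h hh]
  by_cases hu2 : u * u = 1
  · -- Case (i): `u` is an involution of `H` with `u x = y`, `u y = x`
    have huy : u * y = x := by
      rw [← hux, ← mul_assoc, hu2, one_mul]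
    refine ⟨u, hu1, hu2, fun z hz => ?_⟩
    by_cases hzH : z ∈ H
    · rcases (hS z hzH).1 hz with rfl | rfl
      · rw [hux]; exact hyT
      · rw [huy]; exact hxT
    · obtain ⟨h, hh, rfl⟩ := hoff z hzH
      have hnot : ¬ (h = x ∨ h = y) := (hcT h hh).1 hz
      rw [← mul_assoc, ← hcomm u, mul_assoc, hcT (u * h) (H.mul_mem huH hh)]
      rintro (h1 | h1)
      · apply hnot; right
        have : h = u * x := by
          rw [← h1, ← mul_assoc, hu2, one_mul]
        rw [this, hux]
      · apply hnot; left
        have : h = u * y := by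
          rw [← h1, ← mul_assoc, hu2, one_mul]
        rw [this, huy]
  · -- Case (ii): `u` has order `4`; `H = {x, ux, u²x, u³x}`, `T ∩ H = {x, ux}`; take `v = c u²`
    have hu3 : u ^ 3 ≠ 1 := by
      intro h3
      apply hu1
      have : u ^ 4 = u ^ 3 * u := pow_succ u 3
      rw [hu4, h3, one_mul] at this
      exact this.symm
    have hu2' : u ^ 2 ≠ 1 := by rwa [pow_two]
    have hmemH : ∀ i : ℕ, u ^ i * x ∈ H := fun i => H.mul_mem (H.pow_mem huH i) hx
    have hne : ∀ i j : ℕ, i < j → j < 4 → u ^ i * x ≠ u ^ j * x := by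
      intro i j hij hj4 h
      have h' : u ^ i = u ^ j := mul_right_cancel h
      have : u ^ (j - i) = 1 := by
        rw [← mul_right_cancel_iff (a := u ^ i), one_mul, ← pow_add, Nat.sub_add_cancel hij.le, h']
      obtain ⟨d, hd, hd4⟩ : ∃ d, d = j - i ∧ d < 4 := ⟨j - i, rfl, by omega⟩
      have hd0 : 0 < d := by omega
      rw [← hd] at this
      interval_cases d
      · exact hu1 (by simpa using this)
      · exact hu2' this
      · exact hu3 this
    have hcover : ∀ h : G, h ∈ H → ∃ i : ℕ, i < 4 ∧ h = u ^ i * x := by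
      intro h hh
      have hsub : ({u ^ 0 * x, u ^ 1 * x, u ^ 2 * x, u ^ 3 * x} : Set G) ⊆ (H : Set G) := by
        intro z hz
        simp only [Set.mem_insert_iff, Set.mem_singleton_iff] at hz
        rcases hz with rfl | rfl | rfl | rfl <;> exact hmemH _
      have hcard4 : ({u ^ 0 * x, u ^ 1 * x, u ^ 2 * x, u ^ 3 * x} : Set G).ncard = 4 := by
        rw [Set.ncard_insert_of_notMem, Set.ncard_insert_of_notMem, Set.ncard_pair]
        · exact hne 2 3 (by norm_num) (by norm_num)
        · simp only [Set.mem_insert_iff, Set.mem_singleton_iff, not_or]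
          exact ⟨hne 1 2 (by norm_num) (by norm_num), hne 1 3 (by norm_num) (by norm_num)⟩
        · simp only [Set.mem_insert_iff, Set.mem_singleton_iff, not_or]
          exact ⟨hne 0 1 (by norm_num) (by norm_num), hne 0 2 (by norm_num) (by norm_num),
            hne 0 3 (by norm_num) (by norm_num)⟩
      have hHcard : (H : Set G).ncard = 4 := by
        rw [← hH]; exact (Nat.card_coe_set_eq (H : Set G)).symm
      have hHfin : (H : Set G).Finite := Set.finite_of_ncard_pos (by rw [hHcard]; norm_num)
      have heq := Set.eq_of_subset_of_ncard_le hsub (by rw [hHcard, hcard4]) hHfin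
      have hh' : h ∈ ({u ^ 0 * x, u ^ 1 * x, u ^ 2 * x, u ^ 3 * x} : Set G) := by rw [heq]; exact hh
      simp only [Set.mem_insert_iff, Set.mem_singleton_iff] at hh'
      rcases hh' with h0 | h1 | h2 | h3
      · exact ⟨0, by norm_num, h0⟩
      · exact ⟨1, by norm_num, h1⟩
      · exact ⟨2, by norm_num, h2⟩
      · exact ⟨3, by norm_num, h3⟩
    -- `T ∩ H = {x, u x}`: `x = u⁰ x`, `y = u¹ x`
    have hS' : ∀ i : ℕ, i < 4 → (u ^ i * x = x ∨ u ^ i * x = y ↔ i = 0 ∨ i = 1) := by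
      intro i hi
      have e0 : u ^ i * x = x ↔ i = 0 := by
        constructor
        · intro h
          by_contra hi0
          exact hne 0 i (Nat.pos_of_ne_zero hi0) hi (by simpa using h.symm)
        · rintro rfl; simp
      have e1 : u ^ i * x = y ↔ i = 1 := by
        rw [← hux, show u * x = u ^ 1 * x by rw [pow_one]]
        constructor
        · intro h
          by_contra hi1
          rcases Nat.lt_or_gt_of_ne hi1 with hlt | hgt
          · exact hne i 1 hlt (by norm_num) h
          · exact hne 1 i hgt hi h.symm
        · rintro rfl; rfl
      rw [e0, e1]
    set v : G := c * u ^ 2 with hv_def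
    have hvH : v ∉ H := by
      rw [hv_def, Subgroup.mul_mem_iff_of_index_two hidx]
      exact fun h => hcH (h.2 (H.pow_mem huH 2))
    have hv1 : v ≠ 1 := fun h => hvH (h ▸ H.one_mem)
    have hvv : v * v = 1 := by
      rw [hv_def, mul_assoc, ← mul_assoc (u ^ 2) c, ← hcomm (u ^ 2), mul_assoc, ← mul_assoc c c, hc, one_mul,
        ← pow_add, hu4]
    refine ⟨v, hv1, hvv, fun z hz => ?_⟩
    by_cases hzH : z ∈ H
    · -- `z ∈ {x, ux}`: `v z = c (u² z)` with `u² z ∈ {u²x, u³x} = H ∖ T`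
      obtain ⟨i, hi, rfl⟩ := hcover z hzH
      have hi01 : i = 0 ∨ i = 1 := (hS' i hi).1 ((hS _ hzH).1 hz)
      rw [hv_def, mul_assoc, ← mul_assoc (u ^ 2), ← pow_add, hcT _ (hmemH _), hS' (2 + i) (by omega)]
      omega
    · -- `z = c h`, `h ∈ H ∖ T = {u²x, u³x}`: `v z = u² h ∈ {x, ux}`
      obtain ⟨h, hh, rfl⟩ := hoff z hzH
      have hnot : ¬ (h = x ∨ h = y) := (hcT h hh).1 hz
      obtain ⟨i, hi, rfl⟩ := hcover h hh
      have hi23 : ¬ (i = 0 ∨ i = 1) := fun h01 => hnot ((hS' i hi).2 h01)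
      have : v * (c * (u ^ i * x)) = u ^ (2 + i) * x := by
        rw [hv_def, mul_assoc, ← mul_assoc (u ^ 2) c, ← hcomm (u ^ 2), mul_assoc c, ← mul_assoc c c, hc, one_mul,
          ← mul_assoc, ← pow_add]
      rw [this]
      have hred : u ^ (2 + i) * x = u ^ (2 + i - 4) * x := by
        have : 2 + i = 4 + (2 + i - 4) := by omega
        conv_lhs => rw [this, pow_add, hu4, one_mul]
      rw [hred, hS _ (hmemH _), hS' (2 + i - 4) (by omega)]
      omega

end Group

/-! ## §2 The Galois dictionary of a Galois CM field: conjugation, fibres over a subfield -/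

section Galois

variable {K : Type} [Field K] [NumberField K]

/-- **`σ_{g·c} = σ̄_g`**: right multiplication by complex conjugation `c = IsCMField.complexConj K` (viewed in
`Gal(K/ℚ)`) is complex conjugation of the embeddings `σ_g = φ₀ ∘ g⁻¹` (Mathlib
`IsCMField.complexEmbedding_complexConj`: `φ(c x) = conj(φ x)` for EVERY embedding `φ`). [cite: Shimura1998, §18.2 Lemma (i)] -/
theorem embOf_mul_complexConj [IsCMField K] (φ₀ : K →+* ℂ) (g : K ≃ₐ[ℚ] K) :
    embOf φ₀ (g * (IsCMField.complexConj K).restrictScalars ℚ) = ComplexEmbedding.conjugate (embOf φ₀ g) := by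
  refine RingHom.ext fun x => ?_
  rw [ComplexEmbedding.conjugate_coe_eq, embOf_apply, embOf_apply]
  have hinv : (g * (IsCMField.complexConj K).restrictScalars ℚ).symm x = IsCMField.complexConj K (g.symm x) := by
    apply (g * (IsCMField.complexConj K).restrictScalars ℚ).injective
    rw [AlgEquiv.apply_symm_apply, AlgEquiv.mul_apply, AlgEquiv.restrictScalars_apply,
      IsCMField.complexConj_apply_apply, AlgEquiv.apply_symm_apply]
  rw [hinv]
  exact IsCMField.complexEmbedding_complexConj K φ₀ (g.symm x)

/-- **`σ_{c·g} = σ̄_g`** as well (`φ(c x) = conj(φ x)` for the embedding `φ = φ₀ ∘ g⁻¹`); together with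
`embOf_mul_complexConj` and the injectivity of `g ↦ σ_g` this makes complex conjugation CENTRAL in `Gal(K/ℚ)`
(`complexConj_mul_comm`). [cite: Shimura1998, §18.2 Lemma (i)] -/
theorem embOf_complexConj_mul [IsCMField K] (φ₀ : K →+* ℂ) (g : K ≃ₐ[ℚ] K) :
    embOf φ₀ ((IsCMField.complexConj K).restrictScalars ℚ * g) = ComplexEmbedding.conjugate (embOf φ₀ g) := by
  refine RingHom.ext fun x => ?_
  rw [ComplexEmbedding.conjugate_coe_eq, embOf_apply, embOf_apply]
  have hinv : ((IsCMField.complexConj K).restrictScalars ℚ * g).symm x = g.symm (IsCMField.complexConj K x) := by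
    apply ((IsCMField.complexConj K).restrictScalars ℚ * g).injective
    rw [AlgEquiv.apply_symm_apply, AlgEquiv.mul_apply, AlgEquiv.apply_symm_apply, AlgEquiv.restrictScalars_apply,
      IsCMField.complexConj_apply_apply]
  rw [hinv]
  -- `φ₀ ∘ g⁻¹` is an embedding, so it intertwines `c` with `conj`
  exact IsCMField.complexEmbedding_complexConj K (φ₀.comp g.symm.toRingEquiv.toRingHom) x

/-- **Complex conjugation is central in `Gal(K/ℚ)`** for a Galois CM field (both `σ_{gc}` and `σ_{cg}` are `σ̄_g`,
and `g ↦ σ_g` is injective). [cite: Shimura1998, §18.2 Lemma (i)] -/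
theorem complexConj_mul_comm [IsCMField K] [Normal ℚ K] (g : K ≃ₐ[ℚ] K) :
    (IsCMField.complexConj K).restrictScalars ℚ * g = g * (IsCMField.complexConj K).restrictScalars ℚ := by
  obtain ⟨φ₀⟩ := (inferInstance : Nonempty (K →+* ℂ))
  apply (embOf_bijective φ₀).1
  rw [embOf_complexConj_mul, embOf_mul_complexConj]

/-- `c² = 1` in `Gal(K/ℚ)`. [cite: Shimura1998, §18.2 Lemma (i)] -/
theorem complexConj_mul_self [IsCMField K] :
    (IsCMField.complexConj K).restrictScalars ℚ * (IsCMField.complexConj K).restrictScalars ℚ = 1 := by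
  refine AlgEquiv.ext fun x => ?_
  rw [AlgEquiv.mul_apply, AlgEquiv.restrictScalars_apply, AlgEquiv.restrictScalars_apply,
    IsCMField.complexConj_apply_apply, AlgEquiv.one_apply]

/-- **The CM condition on the Galois group**: `σ_{c g} ∈ Φ ↔ σ_g ∉ Φ`. [cite: Shimura1998, §18.2 Lemma (i)] -/
theorem embOf_complexConj_mul_mem_iff [IsCMField K] (Φ : CMType K) (φ₀ : K →+* ℂ) (g : K ≃ₐ[ℚ] K) :
    embOf φ₀ ((IsCMField.complexConj K).restrictScalars ℚ * g) ∈ Φ.1 ↔ embOf φ₀ g ∉ Φ.1 := by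
  rw [embOf_complexConj_mul]
  exact CMTypeOps.conjugate_mem_iff_notMem Φ _

/-- **The embeddings over `φ₀|_k` are the `σ_h`, `h ∈ Gal(K/k)`**: `σ_g|_k = φ₀|_k ↔ g ∈ Gal(K/k)` (the fixing
subgroup of the intermediate field `k`). [cite: Shimura1998, §8.1] -/
theorem embOf_comp_algebraMap_eq_iff (φ₀ : K →+* ℂ) (k : IntermediateField ℚ K) (g : K ≃ₐ[ℚ] K) :
    (embOf φ₀ g).comp (algebraMap k K) = φ₀.comp (algebraMap k K) ↔ g ∈ k.fixingSubgroup := by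
  rw [← inv_mem_iff (x := g), IntermediateField.mem_fixingSubgroup_iff]
  constructor
  · intro h a ha
    have := RingHom.congr_fun h ⟨a, ha⟩
    simp only [RingHom.coe_comp, Function.comp_apply, embOf_apply] at this
    exact φ₀.injective this
  · intro h
    refine RingHom.ext fun a => ?_
    simp only [RingHom.coe_comp, Function.comp_apply, embOf_apply]
    exact congrArg φ₀ (h a a.2)

/-- Every complex embedding of a subfield `k ⊆ K` is the restriction of some `σ_g` (`Aut(ℂ)` is transitive on
`Hom(k, ℂ)`, tree `isPretransitive_ringEquiv_complex`; `K/ℚ` normal). [cite: Shimura1998, §18.2 Lemma (i)] -/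
theorem exists_embOf_comp_algebraMap_eq [Normal ℚ K] (φ₀ : K →+* ℂ) (k : IntermediateField ℚ K) (τ : k →+* ℂ) :
    ∃ g : K ≃ₐ[ℚ] K, (embOf φ₀ g).comp (algebraMap k K) = τ := by
  haveI := isPretransitive_ringEquiv_complex (K := k)
  obtain ⟨γ, hγ⟩ := MulAction.exists_smul_eq (ℂ ≃+* ℂ) (φ₀.comp (algebraMap k K)) τ
  obtain ⟨g, hg⟩ := (embOf_bijective φ₀).2 (γ.toRingHom.comp φ₀)
  refine ⟨g, ?_⟩
  rw [hg, RingHom.comp_assoc, ← ringEquiv_smul_def, hγ]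

/-- **A subfield with a complex place is moved by complex conjugation**: if some embedding `τ₀` of the intermediate
field `k` is not real then `c ∉ Gal(K/k)` (restrict `σ̄_g = σ_{cg}` to `k` for a `σ_g` over `τ₀`). [cite: Shimura1998, §18.2 Lemma (i)] -/
theorem complexConj_not_mem_fixingSubgroup [IsCMField K] [Normal ℚ K] (k : IntermediateField ℚ K) (τ₀ : k →+* ℂ)
    (hτ₀ : ComplexEmbedding.conjugate τ₀ ≠ τ₀) :
    (IsCMField.complexConj K).restrictScalars ℚ ∉ k.fixingSubgroup := by
  obtain ⟨φ₀⟩ := (inferInstance : Nonempty (K →+* ℂ))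
  obtain ⟨g, hg⟩ := exists_embOf_comp_algebraMap_eq φ₀ k τ₀
  intro hc
  rw [IntermediateField.mem_fixingSubgroup_iff] at hc
  apply hτ₀
  -- `conj ∘ τ₀ = σ_{c g}|_k = τ₀` since `(c g)⁻¹ = g⁻¹ c` and `c` fixes `k`
  refine RingHom.ext fun a => ?_
  rw [← hg, RingHom.comp_apply]
  change ComplexEmbedding.conjugate (embOf φ₀ g) (algebraMap k K a) = embOf φ₀ g (algebraMap k K a)
  rw [← embOf_complexConj_mul, embOf_apply, embOf_apply]
  congr 1
  apply ((IsCMField.complexConj K).restrictScalars ℚ * g).injective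
  rw [AlgEquiv.apply_symm_apply, AlgEquiv.mul_apply, AlgEquiv.apply_symm_apply]
  exact (hc _ a.2).symm

end Galois

end GaloisOctic

end Literature.AlgebraicGeometry.ComplexMultiplication.GaloisOcticStabiliser

end
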